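import Summits.QuantumFields.BalabanUV.T4Continuum.Support.MinimalActionClassSixNeg
import Summits.QuantumFields.BalabanUV.T4Continuum.Support.MinimalActionClassSix
import HarnessLib

/-!
# T⁴ programme, node NE3 — dictionary item S3-D6, file 2: NO SMALL-FIELD BALL LIES IN BAŁABAN's CLASS (6) AT ALL LEVELS
# (the bridge between S3-D6-neg's witness and S3-D6's `ClassSix`)

NE3 formalisation swarm, unit `b2b-balaban-t4-ne3-formalise-leaf-04` (LEAF PROVER 04, gen 2), sub-row S3-D6 (typer ρ34∕ρ35∕ρ39).

WHAT.  File 1 (`MinimalActionClassSix`, p214935) typed the first factor of [Balaban1985Variational]'s class (6) on the torus as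
`ClassSix d L N ε₀ k` (over the tree's `B8Ineq132.InAk`) and proved the k-UNIFORM inclusion of the REGULAR small fields
(`mem_classSix_of_regularSup`) and the LEVELWISE inclusion of the plaquette-only ball under `2(d−1)ε′L^k < ε₀`
(`mem_classSix_of_sfClass_level`).  Leaf-09 g2's `MinimalActionClassSixNeg` (p215102) built, for `d ≥ 2`, `L ≥ 2`, `N ≥ 1`,
every `ε′ > 0` and every `ε₀`, a level `k` and an abelian `U ∈ sfClass d L N ε′ k` with `¬ InAk L k ((L^k)⁻¹) ε₀ (fun _ ↦ univ) U`.
THIS FILE (0 def, 0 sorry; three corollaries BY NAME) states the consequence in `ClassSix` currency: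
* `exists_mem_sfClass_not_mem_classSix` — a member of the plaquette-only ball outside class (6);
* **`not_forall_sfClass_subset_classSix`** — `¬ ∀ k, sfClass d L N ε′ k ⊆ ClassSix d L N ε₀ k`: the binder
  `hsub : ∀ j, sfClass d L N ε′ j ⊆ 𝒞 j` of `MinimalActionClassAgnostic.actionRate_of_exists_approx_class` is UNSATISFIABLE at
  `𝒞 = ClassSix d L N ε₀` for every radius `ε′ > 0` — the menu item «(6)_{ε₀} ⊇ sfClass ε′ for a displayed ε′(ε₀, d)» (journal
  l.10505) has NO solution; the class-(6) reading of route (A) goes through competitor MEMBERSHIP (file 1 §5 for the refined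
  competitor; the averaged competitor's current = skeleton risk (r3));
* `not_exists_radius_sfClass_subset_classSix` — the same with the radius existentially bound.

HONEST FRAMING.  Bookkeeping over two landed files; no minimiser, nothing printed is a hypothesis, no `def`, no `sorry`, axioms ⊆
{propext, Classical.choice, Quot.sound}.  **NE3 is NOT proved**; route (A) stays CONDITIONAL on (H∃) (over `sfClass`) resp.
(H∃)+(r3) (over class (6)); spine PROVED 0∕9; finite T⁴ rung (B)+1 — NOT infinite volume, NOT a mass gap, NOT the Clay problem.
HONEST DEPENDENCY: continuum YM on T⁴ ⇐ BetaPertH ∧ nine spine estimates (0/9 proved); BetaPertH ⇐ (D1) ∧ (D4) ∧ CAP+tail;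
G-an2-4 gates asym, D1 and NE2/3/4.
-/

set_option autoImplicit false

open scoped BigOperators Matrix Matrix.Norms.L2Operator

namespace Summit.QuantumFields.BalabanUV.T4Continuum.MinimalActionClassSixNoBall

open Literature.MathematicalPhysics.QuantumFieldTheory.Balaban1983to89
open B7Prop1Explicit B7Prop2Explicit
open T4AveragingDeficitWall hiding Site Plane Plaq Bond
open MinimalActionRate (sfClass)
open MinimalActionClassSix (ClassSix)
open MinimalActionClassSixNeg (exists_mem_sfClass_not_inAk)

variable {d : ℕ} {n : Type*} [Fintype n] [DecidableEq n] [Nonempty n]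

/-- **A MEMBER OF THE PLAQUETTE-ONLY BALL OUTSIDE CLASS (6)**: for `d ≥ 2`, `L ≥ 2`, `N ≥ 1`, every `ε′ > 0` and every `ε₀`
there are a level `k` and `U ∈ sfClass d L N ε′ k` with `U ∉ ClassSix d L N ε₀ k` (leaf-09 g2's abelian witness, whose
current clause (1.9) fails). [folklore] -/
theorem exists_mem_sfClass_not_mem_classSix (hd : 2 ≤ d) {L : ℕ} (hL : 2 ≤ L) {N : ℕ} (hN : 1 ≤ N) {ε' : ℝ}
    (hε : 0 < ε') (ε₀ : ℝ) :
    ∃ (k : ℕ) (U : Site d → Fin d → (Matrix n n ℂ)ˣ), U ∈ sfClass (n := n) d L N ε' k ∧ U ∉ ClassSix d L N ε₀ k := by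
  obtain ⟨k, U, hU, hnot⟩ := exists_mem_sfClass_not_inAk (n := n) hd hL hN hε ε₀
  exact ⟨k, U, hU, fun h => hnot h.2.2⟩

/-- **NO RADIUS PUTS THE SMALL-FIELD BALL INSIDE CLASS (6) AT ALL LEVELS**: for `d ≥ 2`, `L ≥ 2`, `N ≥ 1`, `ε′ > 0` and any
`ε₀`, `¬ ∀ k, sfClass d L N ε′ k ⊆ ClassSix d L N ε₀ k` — the binder `hsub` of the class-agnostic END is unsatisfiable at
`𝒞 = ClassSix d L N ε₀`. [folklore] -/
theorem not_forall_sfClass_subset_classSix (hd : 2 ≤ d) {L : ℕ} (hL : 2 ≤ L) {N : ℕ} (hN : 1 ≤ N) {ε' : ℝ}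
    (hε : 0 < ε') (ε₀ : ℝ) : ¬ ∀ k : ℕ, sfClass (n := n) d L N ε' k ⊆ ClassSix d L N ε₀ k := by
  intro h
  obtain ⟨k, U, hU, hnot⟩ := exists_mem_sfClass_not_mem_classSix (n := n) hd hL hN hε ε₀
  exact hnot (h k hU)

/-- The same with the radius bound existentially: there is NO `ε′ > 0` with `sfClass d L N ε′ k ⊆ ClassSix d L N ε₀ k` for
all `k`. [folklore] -/
theorem not_exists_radius_sfClass_subset_classSix (hd : 2 ≤ d) {L : ℕ} (hL : 2 ≤ L) {N : ℕ} (hN : 1 ≤ N) (ε₀ : ℝ) :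
    ¬ ∃ ε' : ℝ, 0 < ε' ∧ ∀ k : ℕ, sfClass (n := n) d L N ε' k ⊆ ClassSix d L N ε₀ k :=
  fun ⟨_, hε, h⟩ => not_forall_sfClass_subset_classSix (n := n) hd hL hN hε ε₀ h

end Summit.QuantumFields.BalabanUV.T4Continuum.MinimalActionClassSixNoBall
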